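import Summits.ValiantsHypothesis.ValiantsHypothesis.Theorems.LacunarySymmetroidMatrixDescartesDoorA26WallBubblingBubblingNormalisation
import Summits.ValiantsHypothesis.ValiantsHypothesis.Theorems.LacunarySymmetroidMatrixDescartesDoorA26WallBubblingPureDSieve

/-!
# Wall bubbling for `DoorA26` — (W-split) linking, rung 6: NULL COLLAPSE (two dead letters with a dead pairing are parallel) — a door-free exclusion of tight-chain profiles

HONEST FRAMING.  Chain lemma for obligation (W) `stub_weylFaces` of `Cruxes/DoorA26/Lines/wall_bubbling.lean` (stmt-ValiantsHypothesis-19979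
`DoorA26`; OPEN, typed, never asserted), W2 seat val-sym-door-p1 g15; named residual `NoTightChain26` of `Cruxes/DoorA26/Lines/wall_bubbling_ConfluentDoor.lean`
rev 5.  ELEMENTARY LORENTZIAN GEOMETRY of `(Sym₂(ℝ), det) ≅ ℝ^{1,2}`, applied to the limit letters `W_c : Fin 6 → Sym₂(ℝ)` of a cluster of a tight chain
(`…TightChain.tightChain` #26, `…TightIntervals` #28):

* NULL COLLAPSE is the tree's `exists_smul_of_polar_eq_zero` (W-line (D) file `…WallBubblingPureDSieve`, p610269): two SINGULAR symmetric
  `2 × 2` matrices (null vectors of `det`) with `polar = 0` are PROPORTIONAL unless one is `0` (Witt index one).  This file adds its use: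
* `polar_eq_zero_iff_of_null_collapse` — such a pair has the SAME dead pairings with every third matrix: `polar(R, A) = 0 ↔ polar(R, B) = 0`;
* `null_collapse_exclusion` — the exclusion in the form the profile census uses: letters `A, B` both dead on the diagonal (`det A = det B = 0`) with a
  dead pairing (`polar A B = 0`), a witness that each is non-zero (an alive pairing `polar A X ≠ 0`, `polar B Y ≠ 0`), and a third letter `R` paired
  ALIVE with `A` but DEAD with `B` ⇒ `False`.

WHY IT MATTERS (located census `HOME/val-sym-door-p1/g15/PROFILE-CENSUS.md` + `census/nullcollapse.py`, this seat): in a cluster of a tight chain the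
active values form an INTERVAL of the fifteen pair-sum values (#28), so every letter whose square lies outside the interval is dead on the diagonal,
any two of them on the same side have a dead pairing, and each is non-zero as soon as one of its pairings lies inside the interval (convexity +
coverage make every inside value alive); `null_collapse_exclusion` then kills every profile in which the interval's endpoint separates the pairings
of two such letters with a common third letter.  On the combinatorial envelope of `NoTightChain26` with two clusters this excludes 2 176 of the
4 256 profiles (178 of the 224 balanced (10,10) splits) DOOR-FREE — the typed deficit doors touch 522, all at the ends.  The kernel statement of that
exclusion for the chain itself is bookkeeping over #26/#28 (next file); this file is the geometric lemma.

No new definitions; nothing here bears on `DoorA26`, `MatrixDescartes` (stmt-ValiantsHypothesis-18050) or `VP ≠ VNP`; (W)/(W-split)/`ConfluentDoor26`/`NoTightChain26` OPEN.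

[folklore] isotropic vectors of a Lorentzian form; [this work] the use.
-/

-- `Summit.ValiantsHypothesis.ValiantsHypothesis.…` repeats a component by the D-0017 layout
-- (single-conjunct summit), which the `dupNamespace` linter flags; the name is mandated.
set_option linter.dupNamespace false

namespace Summit.ValiantsHypothesis.ValiantsHypothesis.Theorems.LacunarySymmetroidMatrixDescartes.WallBubbling

open Bubbling (polar polar_apply)

/-- `polar (c • A) B = c * polar A B`. [folklore] -/
theorem polar_const_smul_left (c : ℝ) (A B : Matrix (Fin 2) (Fin 2) ℝ) : polar (c • A) B = c * polar A B := by
  rw [polar_apply, polar_apply]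
  simp only [Matrix.smul_apply, smul_eq_mul]
  ring

/-- **Same dead pairings.**  Under null collapse (`det A = det B = 0`, `polar A B = 0`, both non-zero), a third matrix `R` pairs dead with `A`
iff it pairs dead with `B`. [this work] -/
theorem polar_eq_zero_iff_of_null_collapse (A B R : Matrix (Fin 2) (Fin 2) ℝ) (hA : A.IsSymm) (hB : B.IsSymm)
    (hdA : A.det = 0) (hdB : B.det = 0) (hAB : polar A B = 0) (hA0 : A ≠ 0) (hB0 : B ≠ 0) :
    polar R A = 0 ↔ polar R B = 0 := by
  -- null collapse (tree lemma, (D) file): `A = c • B`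
  obtain ⟨c, hc⟩ := exists_smul_of_polar_eq_zero hA hB hdA hdB hB0 (by simpa [polar] using hAB)
  have hc0 : c ≠ 0 := by
    rintro rfl
    exact hA0 (by rw [hc, zero_smul])
  rw [Bubbling.polar_comm R A, Bubbling.polar_comm R B, hc, polar_const_smul_left]
  constructor
  · intro h
    rcases mul_eq_zero.mp h with h | h
    · exact absurd h hc0
    · exact h
  · intro h
    rw [h, mul_zero]

/-- A matrix with an alive pairing is non-zero. [folklore] -/
theorem ne_zero_of_polar_ne_zero (A X : Matrix (Fin 2) (Fin 2) ℝ) (h : polar A X ≠ 0) : A ≠ 0 := by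
  rintro rfl
  apply h
  rw [polar_apply]
  simp

/-- **NULL-COLLAPSE EXCLUSION** (the form the profile census applies cluster by cluster): two letters dead on the diagonal with a dead mutual pairing,
each with some alive pairing, cannot have a third letter paired alive with one and dead with the other. [this work] -/
theorem null_collapse_exclusion (A B R X Y : Matrix (Fin 2) (Fin 2) ℝ) (hA : A.IsSymm) (hB : B.IsSymm)
    (hdA : A.det = 0) (hdB : B.det = 0) (hAB : polar A B = 0)
    (hX : polar A X ≠ 0) (hY : polar B Y ≠ 0)
    (halive : polar R A ≠ 0) (hdead : polar R B = 0) : False :=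
  halive ((polar_eq_zero_iff_of_null_collapse A B R hA hB hdA hdB hAB
    (ne_zero_of_polar_ne_zero A X hX) (ne_zero_of_polar_ne_zero B Y hY)).mpr hdead)

end Summit.ValiantsHypothesis.ValiantsHypothesis.Theorems.LacunarySymmetroidMatrixDescartes.WallBubbling
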